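import Mathlib
import Literature.Computability.AlgebraicComplexity.NestFreeMatchingPoly
import Literature.Computability.AlgebraicComplexity.CircuitDepth
import Literature.Computability.AlgebraicComplexity.QuasiPolynomialFormulasProofs
import Summits.ValiantsHypothesis.ValiantsHypothesis.Theorems.DivisionGapShadowCofactorSplitFormula
import Summits.ValiantsHypothesis.ValiantsHypothesis.Theorems.FifoMatchingNFPolytopeQueueGridFaceDefs
import Summits.ValiantsHypothesis.ValiantsHypothesis.Theses.FifoMatching
import HarnessLib

/-!
# S — the NFP shadow hypothesis gives THE RUNG R2, BY NAME against the route item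
# `Theses.FifoMatching.NNQuasiPolyLogDegreeCofactorHard` (stmt-ValiantsHypothesis-27271)

Port to `Theorems/` (director-valiant g12 R180 (b)(i) / R193 (b), val-lit desk #270 (c): val-port-2 lineage = S-port
hand, file F5) of § S of val-idea-7 g7's kernel-checked line workfile
`Cruxes/NNLinearDegreeCofactorHard/Lines/shadow_division.lean` rev 7 (`nn_ncard_extremePoints_le_of_multiple`,
`exists_exponent_nn`, `rung_of_shadow`; crit-3 VERDICT #21/#21b PASS-WITH-PRICE), verbatim bodies, with NO definitions:
the line's σ-currency `NFPShadowHard` / `shadowVerts` / `T` is UNFOLDED in the hypothesis (crit-3 #21b port note (a)),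
and the conclusion is the route decl R2 `NNQuasiPolyLogDegreeCofactorHard` BY NAME (tenure g12 item stmt-27271, filed
2026-08-28T09:30Z; its inlined `NN_n` is `nestFreeMatchingPoly n ℝ≥0` by `rfl`), so that the line file takes it as
`rung_of_shadow hS := GridCorShadow.rung_of_shadow hS` by plain definitional unfolding.

* `nn_ncard_extremePoints_le_of_multiple` — **HY21 Thm 42 for the tree's formula model, NN instance** (twin of the
  kernel-checked Birkhoff instance `DivisionGap.ShadowCofactorSplit.ncard_extremePoints_le_of_multiple`): if `h' ≠ 0`
  then every planar shadow `L(NFP_n)`, `NFP_n = conv(suppPts NN_n)`, has at most `4·(3·E₊(NN_n·h') + 1)` vertices,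
  `E₊ = formulaComplexity` over `ℝ≥0` — four separating coordinate pencils
  (`ncard_extremePoints_le_of_separating_pencils`), a Minkowski summand has at most as many uniquely supported points
  (`sh_le_sh_mul`, supports are exact over `ℝ≥0`), and the formula bound `sh_eval_le`.
* `exists_exponent_nn` — exponent bookkeeping `18 E² + 4 ≤ (ℓ + c₃)^{c₃}`, `E = (ℓ + k')^{k'} + 2ℓ + 5` (`c₃ = 2k' + 7`;
  self-contained, so that this file imports only the route-independent pencil calculus
  `DivisionGapShadowCofactorSplitFormula`, not the `Theses.DivisionGap`-importing item file).
* `rung_of_shadow_lib` — S over the library polynomial: if for every `c`, eventually in `n`, some planar shadow of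
  `suppPts NN_n` has `> 2^((log₂ n + c)^c)` hull vertices (N1 `NFPShadowHard`, unfolded), then for every `k, c`,
  eventually in `n`, every `h ≠ 0` with `deg h ≤ 2^((log₂ n + k)^k)` has `2^((log₂ n + c)^c) < L₊(NN_n · h)`.  Proof
  (HY21 Prop 43(2)/Rem 20 with BCS balancing): if R2 failed at `(k, c)` for a large `n` and `h ≠ 0`, then
  `deg(NN_n·h) ≤ n + 2^{(ℓ+k')^{k'}}`, `#vars = 4n²`, `L₊ ≤ 2^{(ℓ+c)^c}` (`k' = k + c + 1`, `ℓ = log₂ n`), so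
  `formulaComplexity_le_two_pow` (BCS (21.35)/(21.36), any commutative semiring) gives a monotone formula of size
  `2^{18E²}` and EVERY shadow of `NFP_n` has `≤ 2^{18E²+4} ≤ 2^{(ℓ+c₃)^{c₃}}` vertices — contradicting N1 at `c₃`.
* ★ `rung_of_shadow` — the same with the conclusion stated as the route decl
  `Summit.ValiantsHypothesis.ValiantsHypothesis.Theses.FifoMatching.NNQuasiPolyLogDegreeCofactorHard` BY NAME.

HONEST FRAMING: a CONDITIONAL transfer inside an OPEN line — its hypothesis N1 is OPEN (in the line it follows from
A1 `QueueGridZeroOnePoints` OPEN + G♭ = stmt-27045 OPEN via the landed T1 `GridCorShadow.ppShadow_of_grid`, «G♭ ⇒ G»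
`GridCorShadow.gridCorShadowHard_of_cliqueFace` and the line's T2); stmt-27271 stays OPEN; no rung of record moves;
nothing here bears on `VP ≠ VNP`, which is NOT proved.

References: P. Hrubeš, A. Yehudayoff, *Shadows of Newton polytopes*, CCC 2021 (LIPIcs 200:9), Thm 1, Lemma 12,
Thm 42, Prop 43(2)/Rem 20 [HrubesYehudayoff2021]; P. Bürgisser, M. Clausen, M. A. Shokrollahi, *Algebraic Complexity
Theory* (1997), (21.35)/(21.36) [BurgisserClausenShokrollahi1997].
-/

set_option autoImplicit false

-- the mandated summit-side namespace repeats a component by design (single-problem summit)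
set_option linter.dupNamespace false

noncomputable section

namespace Summit.ValiantsHypothesis.ValiantsHypothesis.Theorems.FifoMatching

namespace GridCorShadow

open scoped NNReal Pointwise
open MvPolynomial
open Literature.Computability.AlgebraicComplexity
open Summit.ValiantsHypothesis.DivisionGap.ShadowDegreeSplit
open Summit.ValiantsHypothesis.ValiantsHypothesis.Theorems.DivisionGap.ShadowCofactorSplit
open Summit.ValiantsHypothesis.ValiantsHypothesis.Theorems.FifoMatching.QueueGridFace (realOf suppPts)

section Port

local notation3 (prettyPrint := false) "PT[" φ ", " f "]" =>
  (⇑φ) '' ((MvPolynomial.support f : Finset _) : Set _)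

local notation3 (prettyPrint := false) "SH[" φ ", " c ", " d ", " f "]" =>
  Set.ncard {p | p ∈ PT[φ, f] ∧ ∃ t : ℝ, ∀ q ∈ PT[φ, f], q ≠ p → c q + t * d q < c p + t * d p}

/-- **HY21 Thm 42 for the tree's formula model, NN instance** (port of
`DivisionGap.ShadowCofactorSplit.ncard_extremePoints_le_of_multiple`): if `h' ≠ 0` then every planar shadow of
`NFP_n = conv(suppPts NN_n)` has at most `4(3·E₊(NN_n·h') + 1)` vertices, `E₊ = formulaComplexity` over `ℝ≥0`.
[cite: HrubesYehudayoff2021, Thm. 42 (= Thm. 1 with Lemma 12)] -/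
theorem nn_ncard_extremePoints_le_of_multiple {n : ℕ}
    (L : ((Fin (2 * n) × Fin (2 * n)) → ℝ) →ₗ[ℝ] (Fin 2 → ℝ))
    (h' : MvPolynomial (Fin (2 * n) × Fin (2 * n)) ℝ≥0) (hh' : h' ≠ 0) :
    (Set.extremePoints ℝ (convexHull ℝ (L '' suppPts (nestFreeMatchingPoly n ℝ≥0)))).ncard ≤
      4 * (3 * formulaComplexity (nestFreeMatchingPoly n ℝ≥0 * h') + 1) := by
  classical
  let φ : ((Fin (2 * n) × Fin (2 * n)) →₀ ℕ) →+ (Fin 2 → ℝ) :=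
    { toFun := fun m => L (realOf m)
      map_zero' := by
        show L (realOf (0 : (Fin (2 * n) × Fin (2 * n)) →₀ ℕ)) = 0
        have h0 : realOf (0 : (Fin (2 * n) × Fin (2 * n)) →₀ ℕ) = 0 := by
          funext ij
          simp [realOf]
        rw [h0, map_zero]
      map_add' := by
        intro a b
        show L (realOf (a + b)) = L (realOf a) + L (realOf b)
        rw [← map_add]
        congr 1
        funext ij
        simp [realOf, Nat.cast_add] }
  have hPT : PT[φ, nestFreeMatchingPoly n ℝ≥0] = L '' suppPts (nestFreeMatchingPoly n ℝ≥0) := by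
    change (fun m => L (realOf m)) '' _ = _
    rw [suppPts, Set.image_image]
  obtain ⟨P, hF, hfan, hcomp, hsize⟩ :=
    ArithCircuit.exists_computes_size_eq_formulaComplexity (nestFreeMatchingPoly n ℝ≥0 * h')
  have hfin : (L '' suppPts (nestFreeMatchingPoly n ℝ≥0)).Finite := by
    rw [← hPT]
    exact finite_pts φ _
  refine ncard_extremePoints_le_of_separating_pencils _ hfin _ fun c d hsep => ?_
  rw [← hPT]
  calc SH[φ, c, d, nestFreeMatchingPoly n ℝ≥0]
      ≤ SH[φ, c, d, nestFreeMatchingPoly n ℝ≥0 * h'] := sh_le_sh_mul φ c d _ _ hh' hsep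
    _ = SH[φ, c, d, P.eval] := by rw [show P.eval = nestFreeMatchingPoly n ℝ≥0 * h' from hcomp]
    _ ≤ 3 * P.size + 1 := sh_eval_le φ c d P hF hfan
    _ = 3 * formulaComplexity (nestFreeMatchingPoly n ℝ≥0 * h') + 1 := by rw [hsize]

end Port

/-- exponent bookkeeping for S: `18 E² + 4 ≤ (ℓ + c₃)^{c₃}` with `E = (ℓ + k')^{k'} + 2ℓ + 5` and `c₃ = 2k' + 7`
(everything is a power of `y = ℓ + k' + 3 ≥ 3`: `E ≤ 3 y^{k'+1}`, `18·9 + 4 ≤ 166 ≤ y⁵`). -/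
theorem exists_exponent_nn (k' : ℕ) : ∃ c₃ : ℕ, ∀ ℓ : ℕ,
    18 * ((ℓ + k') ^ k' + 2 * ℓ + 5) ^ 2 + 4 ≤ (ℓ + c₃) ^ c₃ := by
  refine ⟨2 * k' + 7, fun ℓ => ?_⟩
  set y := ℓ + k' + 3 with hy
  have hy3 : 3 ≤ y := by omega
  have h1 : (ℓ + k') ^ k' ≤ y ^ k' := Nat.pow_le_pow_left (by omega) k'
  have h2 : y ^ k' ≤ y ^ (k' + 1) := Nat.pow_le_pow_right (by omega) (by omega)
  have h3 : y ≤ y ^ (k' + 1) := by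
    calc y = y ^ 1 := (pow_one y).symm
      _ ≤ y ^ (k' + 1) := Nat.pow_le_pow_right (by omega) (by omega)
  have hE : (ℓ + k') ^ k' + 2 * ℓ + 5 ≤ 3 * y ^ (k' + 1) := by omega
  have hsq : ((ℓ + k') ^ k' + 2 * ℓ + 5) ^ 2 ≤ 9 * (y ^ (k' + 1)) ^ 2 := by
    calc ((ℓ + k') ^ k' + 2 * ℓ + 5) ^ 2 ≤ (3 * y ^ (k' + 1)) ^ 2 := Nat.pow_le_pow_left hE 2
      _ = 9 * (y ^ (k' + 1)) ^ 2 := by ring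
  have hP1 : 1 ≤ (y ^ (k' + 1)) ^ 2 := Nat.one_le_pow _ _ (by positivity)
  have h243 : 243 ≤ y ^ 5 := by
    calc (243 : ℕ) = 3 ^ 5 := by norm_num
      _ ≤ y ^ 5 := Nat.pow_le_pow_left hy3 5
  calc 18 * ((ℓ + k') ^ k' + 2 * ℓ + 5) ^ 2 + 4
      ≤ 18 * (9 * (y ^ (k' + 1)) ^ 2) + 4 * (y ^ (k' + 1)) ^ 2 := by
        have := Nat.mul_le_mul_left 18 hsq
        have := Nat.mul_le_mul_left 4 hP1
        omega
    _ = 166 * (y ^ (k' + 1)) ^ 2 := by ring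
    _ ≤ y ^ 5 * (y ^ (k' + 1)) ^ 2 := Nat.mul_le_mul_right _ (by omega)
    _ = y ^ (2 * k' + 7) := by ring
    _ ≤ (ℓ + (2 * k' + 7)) ^ (2 * k' + 7) := Nat.pow_le_pow_left (by omega) _

/-- **S over the library polynomial** — the shadow hypothesis N1 (`NFPShadowHard`, unfolded) gives the rung R2 stated
over `nestFreeMatchingPoly n ℝ≥0` (NN twin of the kernel-checked `DivisionGap.shadowCofactorSplit_proof`, without
degree reduction): if R2 fails at `(k, c)` then for the large `n` and `h ≠ 0` witnessing it,
`deg(NN_n·h) ≤ n + 2^{(ℓ+k')^{k'}}`, `#vars = 4n²`, `L₊ ≤ 2^{(ℓ+c)^c}` (`k' = k + c + 1`), so `formulaComplexity_le_two_pow`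
gives a monotone formula of size `2^{18E²}`, `E = (ℓ+k')^{k'} + 2ℓ + 5`, and by `nn_ncard_extremePoints_le_of_multiple`
EVERY shadow of `NFP_n` has `≤ 2^{18E²+4} ≤ 2^{(ℓ+c₃)^{c₃}}` vertices — contradicting N1 at `c₃`.
[cite: HrubesYehudayoff2021, Thm 42 and Prop 43(2)/Rem 20] [cite: BurgisserClausenShokrollahi1997, Thm (21.35)/(21.36)] -/
theorem rung_of_shadow_lib
    (hS : ∀ c : ℕ, ∃ n₀ : ℕ, ∀ n ≥ n₀, ∃ L : ((Fin (2 * n) × Fin (2 * n)) → ℝ) →ₗ[ℝ] (Fin 2 → ℝ),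
      2 ^ ((Nat.log 2 n + c) ^ c) <
        (Set.extremePoints ℝ (convexHull ℝ (L '' suppPts (nestFreeMatchingPoly n ℝ≥0)))).ncard) :
    ∀ k c : ℕ, ∃ n₀ : ℕ, ∀ n ≥ n₀, ∀ h : MvPolynomial (Fin (2 * n) × Fin (2 * n)) ℝ≥0, h ≠ 0 →
      h.totalDegree ≤ 2 ^ ((Nat.log 2 n + k) ^ k) →
        2 ^ ((Nat.log 2 n + c) ^ c) < complexity (nestFreeMatchingPoly n ℝ≥0 * h) := by
  intro k c
  set k' := k + c + 1 with hk'
  obtain ⟨c₃, hc₃⟩ := exists_exponent_nn k'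
  obtain ⟨n₀, hn₀⟩ := hS c₃
  refine ⟨n₀, fun n hn h hh hdeg => ?_⟩
  by_contra hs
  push Not at hs
  obtain ⟨L, hL⟩ := hn₀ n hn
  set ℓ := Nat.log 2 n with hℓ
  set B := (ℓ + k') ^ k' with hB
  have hk1 : 1 ≤ ℓ + k' := by omega
  have hkB : (ℓ + k) ^ k ≤ B := by
    rcases Nat.eq_zero_or_pos k with hk0 | hkpos
    · subst hk0; rw [pow_zero]; exact Nat.one_le_pow _ _ hk1
    · exact (Nat.pow_le_pow_left (by omega) k).trans (Nat.pow_le_pow_right hk1 (by omega))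
  have hcB : (ℓ + c) ^ c ≤ B := by
    rcases Nat.eq_zero_or_pos c with hc0 | hcpos
    · rw [hc0, pow_zero]; exact Nat.one_le_pow _ _ hk1
    · exact (Nat.pow_le_pow_left (by omega) c).trans (Nat.pow_le_pow_right hk1 (by omega))
  set E := B + 2 * ℓ + 5 with hE
  have h2E : 2 ^ E = 2 ^ B * 2 ^ (ℓ + 1) * 2 ^ (ℓ + 1) * 8 := by
    rw [hE, show B + 2 * ℓ + 5 = B + (ℓ + 1) + (ℓ + 1) + 3 by omega, pow_add, pow_add, pow_add]
    norm_num
  have hnlt : n < 2 ^ (ℓ + 1) := Nat.lt_pow_succ_log_self Nat.one_lt_two n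
  have ha1 : 1 ≤ 2 ^ B := Nat.one_le_two_pow
  have hb1 : 1 ≤ 2 ^ (ℓ + 1) := Nat.one_le_two_pow
  have hprod : 2 ^ (ℓ + 1) * 2 ^ (ℓ + 1) ≤ 2 ^ B * 2 ^ (ℓ + 1) * 2 ^ (ℓ + 1) := by
    calc 2 ^ (ℓ + 1) * 2 ^ (ℓ + 1) = 1 * 2 ^ (ℓ + 1) * 2 ^ (ℓ + 1) := by ring
      _ ≤ 2 ^ B * 2 ^ (ℓ + 1) * 2 ^ (ℓ + 1) := Nat.mul_le_mul_right _ (Nat.mul_le_mul_right _ ha1)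
  have hsq : 2 ^ (ℓ + 1) ≤ 2 ^ (ℓ + 1) * 2 ^ (ℓ + 1) := Nat.le_mul_of_pos_right _ (by omega)
  have hBle : 2 ^ B ≤ 2 ^ B * 2 ^ (ℓ + 1) * 2 ^ (ℓ + 1) := by
    calc 2 ^ B = 2 ^ B * 1 * 1 := by ring
      _ ≤ 2 ^ B * 2 ^ (ℓ + 1) * 2 ^ (ℓ + 1) := Nat.mul_le_mul (Nat.mul_le_mul_left _ hb1) hb1
  have hd : n + 2 ^ B < 2 ^ E := by rw [h2E]; omega
  have hcard : Fintype.card (Fin (2 * n) × Fin (2 * n)) ≤ 2 ^ E := by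
    rw [Fintype.card_prod, Fintype.card_fin, h2E]
    calc 2 * n * (2 * n) = 4 * (n * n) := by ring
      _ ≤ 4 * (2 ^ (ℓ + 1) * 2 ^ (ℓ + 1)) := Nat.mul_le_mul_left 4 (Nat.mul_le_mul hnlt.le hnlt.le)
      _ ≤ 4 * (2 ^ B * 2 ^ (ℓ + 1) * 2 ^ (ℓ + 1)) := Nat.mul_le_mul_left 4 hprod
      _ ≤ 2 ^ B * 2 ^ (ℓ + 1) * 2 ^ (ℓ + 1) * 8 := by omega
  have hNN : (nestFreeMatchingPoly n ℝ≥0).totalDegree ≤ n := by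
    simpa using (nestFreeMatchingPoly_isHomogeneous (n := n) (k := ℝ≥0)).totalDegree_le
  have hdeg' : (nestFreeMatchingPoly n ℝ≥0 * h).totalDegree ≤ n + 2 ^ B :=
    calc (nestFreeMatchingPoly n ℝ≥0 * h).totalDegree
        ≤ (nestFreeMatchingPoly n ℝ≥0).totalDegree + h.totalDegree := totalDegree_mul _ _
      _ ≤ n + 2 ^ ((ℓ + k) ^ k) := add_le_add hNN hdeg
      _ ≤ n + 2 ^ B := Nat.add_le_add_left (Nat.pow_le_pow_right Nat.two_pos hkB) n
  have hL' : complexity (nestFreeMatchingPoly n ℝ≥0 * h) ≤ 2 ^ E :=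
    hs.trans ((Nat.pow_le_pow_right Nat.two_pos hcB).trans
      ((Nat.pow_le_pow_right Nat.two_pos (by omega : B ≤ E))))
  have hE1 : 1 ≤ E := by omega
  have hfc := formulaComplexity_le_two_pow hdeg' hd hcard hL' hE1
  have hV := nn_ncard_extremePoints_le_of_multiple L h hh
  have hexp : 18 * E ^ 2 + 4 ≤ (ℓ + c₃) ^ c₃ := hc₃ ℓ
  have hfinal : (Set.extremePoints ℝ (convexHull ℝ (L '' suppPts (nestFreeMatchingPoly n ℝ≥0)))).ncard ≤
      2 ^ ((ℓ + c₃) ^ c₃) :=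
    calc (Set.extremePoints ℝ (convexHull ℝ (L '' suppPts (nestFreeMatchingPoly n ℝ≥0)))).ncard
        ≤ 4 * (3 * formulaComplexity (nestFreeMatchingPoly n ℝ≥0 * h) + 1) := hV
      _ ≤ 4 * (3 * 2 ^ (18 * E ^ 2) + 1) :=
          Nat.mul_le_mul_left 4 (Nat.add_le_add_right (Nat.mul_le_mul_left 3 hfc) 1)
      _ ≤ 2 ^ (18 * E ^ 2 + 4) := by
          rw [pow_add]
          have h16 : (2 : ℕ) ^ 4 = 16 := by norm_num
          rw [h16]
          have := Nat.one_le_two_pow (n := 18 * E ^ 2)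
          omega
      _ ≤ 2 ^ ((ℓ + c₃) ^ c₃) := Nat.pow_le_pow_right Nat.two_pos hexp
  exact absurd hL (not_lt.2 hfinal)

/-- ★ **S, BY NAME** — the shadow hypothesis N1 (`NFPShadowHard`, unfolded: for every `c`, eventually in `n`, some
planar linear shadow of `suppPts NN_n` has more than `2^((log₂ n + c)^c)` hull vertices) gives THE RUNG R2 = the route
item `Theses.FifoMatching.NNQuasiPolyLogDegreeCofactorHard` (stmt-ValiantsHypothesis-27271): for every `k, c`,
eventually in `n`, every nonzero cofactor `h` of degree `≤ 2^((log₂ n + k)^k)` has `2^((log₂ n + c)^c) < L₊(NN_n · h)`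
(the route's inlined `NN_n` is `nestFreeMatchingPoly n ℝ≥0` definitionally).  HY21 Prop 43(2)/Rem 20 for `NN_n`.
[cite: HrubesYehudayoff2021, Thm 42 and Prop 43(2)/Rem 20] [cite: BurgisserClausenShokrollahi1997, Thm (21.35)/(21.36)] -/
theorem rung_of_shadow
    (hS : ∀ c : ℕ, ∃ n₀ : ℕ, ∀ n ≥ n₀, ∃ L : ((Fin (2 * n) × Fin (2 * n)) → ℝ) →ₗ[ℝ] (Fin 2 → ℝ),
      2 ^ ((Nat.log 2 n + c) ^ c) <
        (Set.extremePoints ℝ (convexHull ℝ (L '' suppPts (nestFreeMatchingPoly n ℝ≥0)))).ncard) :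
    Summit.ValiantsHypothesis.ValiantsHypothesis.Theses.FifoMatching.NNQuasiPolyLogDegreeCofactorHard :=
  rung_of_shadow_lib hS

end GridCorShadow

end Summit.ValiantsHypothesis.ValiantsHypothesis.Theorems.FifoMatching

end
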